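import Summits.QuantumFields.YangMills.Theorems.BalabanUVNodesN06SectDUnitsAtPins
import Literature.MathematicalPhysics.QuantumFieldTheory.Balaban1983to89.Node00.OpsYGpUnits
import Literature.MathematicalPhysics.QuantumFieldTheory.Balaban1983to89.B9Thm312WholeIdentitiesDefAtPins
import Literature.MathematicalPhysics.QuantumFieldTheory.Balaban1983to89.B9PerturbationMajorantsAtLettersPhys

/-!
# BalabanUVNodes ∕ N06 ([B9], `Dag.B9_main`) — SECT. D's DISPLAYED UNITS Δ_{π,a}(U), Δ⁽¹⁾(U) AND THE POSITIVITY OF Δ_a ∕ Δ⁽¹⁾ AT THE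
# PRINT-UNITS PINS (`GpPhysY`): the four theorems of `…N06SectDUnitsAtPins` re-based for edition 21

Track A of `YM-PLAN.md` (cell `pub-ymgap`, HUMAN RULING D-0062), node **N06** = [Balaban1985BackgroundPropagators] Thms 3.1–3.15;
seat `pub-ymgap-dag-n06-d` (s2, «knit N06 at the ₁₁ record», gen 9).  A HELPER for the stage-11 certificate editions ≥ 21.

WHAT.  UNITS-D1 (dag-n06-l g14, located; node00-def-Y g16 `Node00/OpsYGpUnits` p584417): the Sect. D composites are print's operators only at
`G′_phys = η²·G′_latt =: GpPhysY`; edition 21 of the certificate re-pins the model operators `(𝔬12 x).S0 ∕ .Tpi ∕ .T2 ∕ …` to def-Y's coordinate models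
AT `GpPhysY x.toKIdx (parSymY x.toKIdx)` (letters family `B9LettersYRecordV4Phys.lettersYOfRecordV4Phys`).  The four unit ∕ positivity theorems of
`…N06SectDUnitsAtPins` (p557146 ∕ p562828) are keyed to the lattice pins `GpY i (parSymY i)`; their proofs are `G′`-GENERIC (def-Y's
`deltaPiAY_eq_deltaAY_sub ∕ deltaOneY_eq_deltaAY_sub`, the generic §1∕§3∕§4 facts of that file), so THIS FILE restates and re-proves them at the phys pins:
★ `isUnit_deltaPiAY_of_formSmall_phys`, ★ `isUnit_deltaOneY_of_formSmall_phys`, ★ `posDefEnd_S0coK_of_posDefTr_phys` (input: `PosDefTr 1 (deltaAY … GpPhysY …)`,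
which the certificate gets from its displayed `hΔA` at `GpY` by def-Y `deltaAY_GpPhysY` — the SAME operator), ★ `posDefTr_deltaOneY_of_formSmall_pins_phys`;
and (§2) the knit-side companions of node00-def-Y g17's record `Node00/OpsYRecordV4P` (FILE 29): `isTransposePair_RcoK_phys` (the `R`-model is unchanged —
dag-n06-l `rcoK_GpPhysY`), ★★ `identitiesDef_of_pins_phys` = dag-n06-l g11's `identitiesDef_of_pins` with the Sect.-D letters read at `GpPhysY i (parSymY i)` (the
Sect. A–C letter `G = Δ_a⁻¹` and its unit kept at the lattice letter — the SAME operators, def-Y `GAY_GpPhysY ∕ deltaAY_GpPhysY`; def-Y's identity algebra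
`GcoK_GAY_mul_S0coK ∕ S0coK_sub_TpicoK_mul_GcoK_GDY ∕ … ∕ QcoKH_G1_Qs_C1_eq_id` is `G′`-generic), `isUnit_deltaAY_phys_of_posDefTr`.

HONEST FRAMING.  Finite-dimensional linear algebra, proofs copied from the lattice-pin file with the letter swapped; COUNT-NEUTRAL; nothing of [B9]
asserted — the form smallness itself remains rows 20–21's derived schema; N06 NOT discharged.  One finite 𝕋⁴ programme at fixed `ε` — NOT continuum,
NOT OS, NOT the mass gap ∕ Clay.  0 `def`, 0 `sorry`.
-/

noncomputable section

namespace Summit.QuantumFields.YangMills.BalabanUVNodes.N06SectDUnitsAtPinsPhys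

open Literature.MathematicalPhysics.QuantumFieldTheory.Balaban1983to89
open Literature.MathematicalPhysics.QuantumFieldTheory.Balaban1983to89.Node00
open Literature.MathematicalPhysics.QuantumFieldTheory.Balaban1983to89.Node00.OpsYSectDCoords (S0coK TpicoK T2coK cR39_trBasis_pos coordOpK_sub coordOpK_add repr_assembleK)
open Literature.MathematicalPhysics.QuantumFieldTheory.Balaban1983to89.B9CoReadingCoords (XBK assembleK coordOpK coordOpK_apply)
open Literature.MathematicalPhysics.QuantumFieldTheory.Balaban1983to89.B9CoReadingCoordsTranspose
  (TrIdx trBasis trReForm trReForm_apply assembleK_pairing sum_trReForm_eq_trIP trBasis_repr_eq_trace)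
open Literature.MathematicalPhysics.QuantumFieldTheory.Balaban1983to89.B9Thm39ReadingCoords (cR39)
open Literature.MathematicalPhysics.QuantumFieldTheory.Balaban1983to89.B9Thm312Whole (Ops FormSmall PosDefEnd)
open Literature.MathematicalPhysics.QuantumFieldTheory.Balaban1983to89.B9Thm311ReadingCoords (isUnit_of_injective trIP PosDefTr)
open Literature.MathematicalPhysics.QuantumFieldTheory.Balaban1983to89.B9Eq3132SectDLetters (deltaPiAY)
open Literature.MathematicalPhysics.QuantumFieldTheory.Balaban1983to89.B6KLevelCensusIndexV1 (KIdx)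
open Summit.QuantumFields.YangMills.BalabanUVNodes.N06SectDUnitsAtPins (injective_sub_of_form_bound injective_of_coordOpK_const injective_of_smul_injective
  dotProduct_coordOpK_const_eq_sum_trIP posDefTr_of_posDefEnd_coordOpK_const)
open Literature.MathematicalPhysics.QuantumFieldTheory.Balaban1983to89.Node00.OpsYSectDCoords
open Literature.MathematicalPhysics.QuantumFieldTheory.Balaban1983to89.B9Thm312WholeIdentitiesSplit (IdentitiesDef)
open Literature.MathematicalPhysics.QuantumFieldTheory.Balaban1983to89.B9Thm312Whole (frakPstar)
open Literature.MathematicalPhysics.QuantumFieldTheory.Balaban1983to89.B9CoReadingCoords (GcoK)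
open Literature.MathematicalPhysics.QuantumFieldTheory.Balaban1983to89.B9Eq3132SectDLetters (GDY QGQY QGQinvY HDY)
open Literature.MathematicalPhysics.QuantumFieldTheory.Balaban1983to89.B9CoReadingCoordsH (XHK HcoK)
open Literature.MathematicalPhysics.QuantumFieldTheory.Balaban1983to89.B9CoReadingCoordsS (XSK)
open Literature.MathematicalPhysics.QuantumFieldTheory.Balaban1983to89.B9Thm37Glue (IsTransposePair)
open scoped Matrix
open scoped Matrix.Norms.L2Operator

variable {N : ℕ} {d ℓ : ℕ} {hd : 1 ≤ d + 1} {hL : Odd (ℓ + 1) ∧ 1 < ℓ + 1} {b₀ b₁ : ℝ}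

/-! ## §1 The two units and the two positivities at the phys pins -/

/-- `TrIdx N` is inhabited for `0 < N`. [folklore] -/
private theorem nonempty_trIdx (hN : 0 < N) : Nonempty (TrIdx N) := ⟨(⟨0, hN⟩, ⟨0, hN⟩, 0)⟩

/-- the weighted trace pairing vanishes on a zero left argument. [cite: Balaban1985BackgroundPropagators, p.393 (scalar products), bookkeeping] -/
private theorem trIP_zero_left {S : Type} [Fintype S] (w : S → ℝ) (Ψ : S → Matrix (Fin N) (Fin N) ℂ) : trIP w 0 Ψ = 0 := by
  simp [trIP]

/-- ★ **THE UNIT Δ_{π,a}(U) = Δ_a − Δ′_π ((3.122): G = (Δ_a − Δ′_π)⁻¹ exists) FROM THE FORM SMALLNESS AT THE PINS**: at one member and one U, rows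
20–21's displayed `FormSmall 𝔬 r U` (Δ_a > 0 and |⟨f, Δ′_πf⟩| ≦ r⟨f, Δ_af⟩ on the model operators) with r < 1 and edition 14's pins of `𝔬.S0 ∕ 𝔬.Tpi` to
node00-def-Y's `S0coK ∕ TpicoK` (c⁻¹·coordinate models of Δ_a ∕ Δ′_π over the trace basis) give `IsUnit (deltaPiAY …)` — def-Y's displayed side
condition `hUπ` of the identity (Δ_a − Δ′_π)G = I.  Chain: S0 − Tpi injective (`injective_sub_of_form_bound`) = c⁻¹·coordOpK of Δ_a − Δ′_π
(`coordOpK_sub`, `deltaPiAY_eq_deltaAY_sub`) ⟹ Δ_a − Δ′_π injective (`injective_of_coordOpK_const`) ⟹ unit (n06-j `isUnit_of_injective`, finite lattice).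
[cite: Balaban1985BackgroundPropagators, (3.120)–(3.122) pp.419–420 + Thm 3.11 p.416] -/
theorem isUnit_deltaPiAY_of_formSmall_phys (i : KIdx d ℓ hd hL b₀ b₁) (B : B9.Backgrounds) (cfg : B.Cfg → CfgY (Matrix (Fin N) (Fin N) ℂ) i)
    {g : B9.Geometry} {Y Z W : Type} [Fintype Y] [Fintype Z] [Fintype W]
    (𝔬 : Ops g B (XBK (TrIdx N) i) Y Z W) (U : B.Cfg) {r : ℝ} (hN : 0 < N) (hF : FormSmall 𝔬 r U) (hr : r < 1)
    (hS0 : 𝔬.S0 U = S0coK i (trBasis N) B cfg (parSymY i) (parBY i) (GpPhysY i (parSymY i)) U)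
    (hTpi : 𝔬.Tpi U = TpicoK i (trBasis N) B cfg (parSymY i) (GpPhysY i (parSymY i)) U) :
    IsUnit (deltaPiAY i (parSymY i) (parBY i) (GpPhysY i (parSymY i)) (cfg U)) := by
  haveI : Nonempty (TrIdx N) := nonempty_trIdx hN
  have hinj : Function.Injective (𝔬.S0 U - 𝔬.Tpi U) := injective_sub_of_form_bound _ _ hF.posS0 hF.small hr
  have hEq : 𝔬.S0 U - 𝔬.Tpi U = (cR39 (trBasis N))⁻¹ •
      coordOpK (trBasis N) (fun _ : Fin (d + 1) => (deltaPiAY i (parSymY i) (parBY i) (GpPhysY i (parSymY i)) (cfg U)).restrictScalars ℝ) := by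
    have hfam : (fun _ : Fin (d + 1) => (deltaPiAY i (parSymY i) (parBY i) (GpPhysY i (parSymY i)) (cfg U)).restrictScalars ℝ) =
        fun _ : Fin (d + 1) => (deltaAY i (parSymY i) (parBY i) (GpPhysY i (parSymY i)) (cfg U)).restrictScalars ℝ -
          (deltaPiPrimeY i (parSymY i) (GpPhysY i (parSymY i)) (cfg U)).restrictScalars ℝ := by
      funext ν
      apply LinearMap.ext
      intro v
      simp only [LinearMap.coe_restrictScalars, LinearMap.sub_apply, deltaPiAY_eq_deltaAY_sub]
    rw [hS0, hTpi, hfam, coordOpK_sub, smul_sub]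
    rfl
  rw [hEq] at hinj
  have hinj2 := injective_of_coordOpK_const (trBasis N) _ (injective_of_smul_injective hinj)
  exact isUnit_of_injective (fun u v huv => hinj2 (by simpa only [LinearMap.coe_restrictScalars] using huv))

/-- ★ **THE UNIT Δ⁽¹⁾(U) = Δ_a − Δ′_π − Δ⁽²⁾_π ((3.128): G₁ exists) FROM THE FORM SMALLNESS AT THE PINS**: as `isUnit_deltaPiAY_of_formSmall`, with the
second relative bound `FormSmall.small1` (|⟨f, (Δ′_π + Δ⁽²⁾_π)f⟩| ≦ r⟨f, Δ_af⟩) and the pin of `𝔬.T2` to def-Y's `T2coK` — def-Y's displayed side condition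
`hU1` of the identity (Δ_a − Δ′_π − Δ⁽²⁾_π)G₁ = I. [cite: Balaban1985BackgroundPropagators, (3.128) p.421 + (3.134)–(3.137) pp.422–423 + Thm 3.11 p.416] -/
theorem isUnit_deltaOneY_of_formSmall_phys (i : KIdx d ℓ hd hL b₀ b₁) (B : B9.Backgrounds) (cfg : B.Cfg → CfgY (Matrix (Fin N) (Fin N) ℂ) i)
    (Δ2 : BondOpY (Matrix (Fin N) (Fin N) ℂ) i) {g : B9.Geometry} {Y Z W : Type} [Fintype Y] [Fintype Z] [Fintype W]
    (𝔬 : Ops g B (XBK (TrIdx N) i) Y Z W) (U : B.Cfg) {r : ℝ} (hN : 0 < N) (hF : FormSmall 𝔬 r U) (hr : r < 1)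
    (hS0 : 𝔬.S0 U = S0coK i (trBasis N) B cfg (parSymY i) (parBY i) (GpPhysY i (parSymY i)) U)
    (hTpi : 𝔬.Tpi U = TpicoK i (trBasis N) B cfg (parSymY i) (GpPhysY i (parSymY i)) U)
    (hT2 : 𝔬.T2 U = T2coK i (trBasis N) B cfg (parSymY i) (GpPhysY i (parSymY i)) Δ2 U) :
    IsUnit (deltaOneY i (parSymY i) (parBY i) (GpPhysY i (parSymY i)) Δ2 (cfg U)) := by
  haveI : Nonempty (TrIdx N) := nonempty_trIdx hN
  have hinj : Function.Injective (𝔬.S0 U - (𝔬.Tpi U + 𝔬.T2 U)) := injective_sub_of_form_bound _ _ hF.posS0 hF.small1 hr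
  have hEq : 𝔬.S0 U - (𝔬.Tpi U + 𝔬.T2 U) = (cR39 (trBasis N))⁻¹ •
      coordOpK (trBasis N) (fun _ : Fin (d + 1) => (deltaOneY i (parSymY i) (parBY i) (GpPhysY i (parSymY i)) Δ2 (cfg U)).restrictScalars ℝ) := by
    have hfam : (fun _ : Fin (d + 1) => (deltaOneY i (parSymY i) (parBY i) (GpPhysY i (parSymY i)) Δ2 (cfg U)).restrictScalars ℝ) =
        fun _ : Fin (d + 1) => (deltaAY i (parSymY i) (parBY i) (GpPhysY i (parSymY i)) (cfg U)).restrictScalars ℝ -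
          ((deltaPiPrimeY i (parSymY i) (GpPhysY i (parSymY i)) (cfg U)).restrictScalars ℝ +
            (delta2PiY i (parSymY i) (GpPhysY i (parSymY i)) Δ2 (cfg U)).restrictScalars ℝ) := by
      funext ν
      apply LinearMap.ext
      intro v
      simp only [LinearMap.coe_restrictScalars, LinearMap.sub_apply, LinearMap.add_apply, deltaOneY_eq_deltaAY_sub]
    rw [hS0, hTpi, hT2, hfam, coordOpK_sub, coordOpK_add, smul_sub, smul_add]
    rfl
  rw [hEq] at hinj
  have hinj2 := injective_of_coordOpK_const (trBasis N) _ (injective_of_smul_injective hinj)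
  exact isUnit_of_injective (fun u v huv => hinj2 (by simpa only [LinearMap.coe_restrictScalars] using huv))


/-- ★ **`FormSmall.posS0` AT THE PINS FROM ROW 17's POSITIVITY OF Δ_a(U)**: Theorem 3.11's `PosDefTr 1 (deltaAY …(cfg U₁))` (the certificate's displayed
row 17 `hΔA`, weighted trace pairing) gives the REAL-COORDINATE positivity `PosDefEnd` of node00-def-Y's model `S0coK … U₁ = c⁻¹·coordOpK (Δ_a)` — the
`posS0` member of rows 20–21's `FormSmall` (p. 420 «Δ_a», Theorem 3.11 p. 416), slice by slice (`dotProduct_coordOpK_const_eq_sum_trIP`; a non-zero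
coordinate vector has a non-zero slice, `repr_assembleK`). [cite: Balaban1985BackgroundPropagators, Thm 3.11 p.416 + (3.26) p.395 + (3.120) p.419] -/
theorem posDefEnd_S0coK_of_posDefTr_phys (i : KIdx d ℓ hd hL b₀ b₁) (B : B9.Backgrounds) (cfg : B.Cfg → CfgY (Matrix (Fin N) (Fin N) ℂ) i)
    (U₁ : B.Cfg) (hN : 0 < N)
    (hΔ : PosDefTr (fun _ => (1 : ℝ)) (deltaAY i (parSymY i) (parBY i) (GpPhysY i (parSymY i)) (cfg U₁))) :
    PosDefEnd (S0coK i (trBasis N) B cfg (parSymY i) (parBY i) (GpPhysY i (parSymY i)) U₁) := by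
  classical
  intro f hf
  have hc : 0 < cR39 (trBasis N) := cR39_trBasis_pos hN
  -- a non-zero coordinate vector has a non-zero slice
  obtain ⟨p, hp⟩ : ∃ p, f p ≠ 0 := by
    by_contra h
    exact hf (funext fun q => not_not.mp (not_exists.mp h q))
  have hA : assembleK (trBasis N) p.2.1 p.2.2.2 f ≠ 0 := by
    intro h0
    have h1 := repr_assembleK (trBasis N) f p.1 p.2.1 p.2.2.1 p.2.2.2
    rw [h0] at h1
    simp only [Pi.zero_apply, map_zero, Finsupp.coe_zero] at h1
    exact hp h1.symm
  -- the form is c⁻¹·Σ_{ν,c′} trIP 1 A_{ν,c′} (Δ_a A_{ν,c′})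
  have hform : f ⬝ᵥ S0coK i (trBasis N) B cfg (parSymY i) (parBY i) (GpPhysY i (parSymY i)) U₁ f =
      (cR39 (trBasis N))⁻¹ * ∑ ν : Fin (d + 1), ∑ c' : TrIdx N, trIP (fun _ => (1 : ℝ)) (assembleK (trBasis N) ν c' f)
        ((deltaAY i (parSymY i) (parBY i) (GpPhysY i (parSymY i)) (cfg U₁)).restrictScalars ℝ (assembleK (trBasis N) ν c' f)) := by
    rw [← dotProduct_coordOpK_const_eq_sum_trIP]
    simp only [S0coK, LinearMap.smul_apply, dotProduct_smul, smul_eq_mul]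
  rw [hform]
  refine mul_pos (inv_pos.mpr hc) ?_
  have hnn : ∀ (ν : Fin (d + 1)) (c' : TrIdx N), 0 ≤ trIP (fun _ => (1 : ℝ)) (assembleK (trBasis N) ν c' f)
      ((deltaAY i (parSymY i) (parBY i) (GpPhysY i (parSymY i)) (cfg U₁)).restrictScalars ℝ (assembleK (trBasis N) ν c' f)) := fun ν c' => by
    by_cases h0 : assembleK (trBasis N) ν c' f = 0
    · rw [h0, map_zero, trIP_zero_left]
    · exact (hΔ _ h0).le
  have hpos : 0 < trIP (fun _ => (1 : ℝ)) (assembleK (trBasis N) p.2.1 p.2.2.2 f)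
      ((deltaAY i (parSymY i) (parBY i) (GpPhysY i (parSymY i)) (cfg U₁)).restrictScalars ℝ (assembleK (trBasis N) p.2.1 p.2.2.2 f)) := hΔ _ hA
  calc (0 : ℝ) < _ := hpos
    _ ≤ ∑ c' : TrIdx N, trIP (fun _ => (1 : ℝ)) (assembleK (trBasis N) p.2.1 c' f)
          ((deltaAY i (parSymY i) (parBY i) (GpPhysY i (parSymY i)) (cfg U₁)).restrictScalars ℝ (assembleK (trBasis N) p.2.1 c' f)) :=
        Finset.single_le_sum (fun c' _ => hnn p.2.1 c') (Finset.mem_univ p.2.2.2)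
    _ ≤ _ := Finset.single_le_sum (fun ν _ => Finset.sum_nonneg fun c' _ => hnn ν c') (Finset.mem_univ p.2.1)

/-- ★ **Δ⁽¹⁾(U) = Δ_a − Δ′_π − Δ⁽²⁾_π IS POSITIVE IN TRACE CURRENCY FROM THE FORM SMALLNESS AT THE PINS** — the input `hΔ1 : PosDefTr 1 (deltaOneY …)` of
node00-def-Y g12's `isUnit_QGQOfY_G1Y_record_of_posDefTr` (which discharges the certificate's last displayed unit `hUQ`, [4] (2.35) «QGQ* is positive also»):
rows 20–21's `FormSmall 𝔬 r U` with `r < 1` gives `S0 − (Tpi + T2) > 0` in real coordinates, the pins make it `c⁻¹·coordOpK (Δ⁽¹⁾)`, and §4's one-slice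
encoding returns to the trace pairing.  (The PINS-keyed route; node00-def-Y g12's `Node00.OpsYQOnto.posDefTr_deltaOneY_of_form_small` is the trace-currency
sibling from `PosDefTr 1 (deltaPiAY …)` + a relative trace-form bound on Δ⁽²⁾_π — different hypotheses, one declarer each per dag-lead DEDUP-331 (2).) [cite: Balaban1985BackgroundPropagators, (3.128) p.421 + (3.134)–(3.138) pp.422–423 + Thm 3.11 p.416; Balaban1984PropagatorsII, (2.35) p.229] -/
theorem posDefTr_deltaOneY_of_formSmall_pins_phys (i : KIdx d ℓ hd hL b₀ b₁) (B : B9.Backgrounds) (cfg : B.Cfg → CfgY (Matrix (Fin N) (Fin N) ℂ) i)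
    (Δ2 : BondOpY (Matrix (Fin N) (Fin N) ℂ) i) {g : B9.Geometry} {Y Z W : Type} [Fintype Y] [Fintype Z] [Fintype W]
    (𝔬 : Ops g B (XBK (TrIdx N) i) Y Z W) (U : B.Cfg) {r : ℝ} (hN : 0 < N) (hF : FormSmall 𝔬 r U) (hr : r < 1)
    (hS0 : 𝔬.S0 U = S0coK i (trBasis N) B cfg (parSymY i) (parBY i) (GpPhysY i (parSymY i)) U)
    (hTpi : 𝔬.Tpi U = TpicoK i (trBasis N) B cfg (parSymY i) (GpPhysY i (parSymY i)) U)
    (hT2 : 𝔬.T2 U = T2coK i (trBasis N) B cfg (parSymY i) (GpPhysY i (parSymY i)) Δ2 U) :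
    PosDefTr (fun _ => (1 : ℝ)) (deltaOneY i (parSymY i) (parBY i) (GpPhysY i (parSymY i)) Δ2 (cfg U)) := by
  have hc : 0 < cR39 (trBasis N) := cR39_trBasis_pos hN
  -- S0 − (Tpi + T2) is positive in real coordinates: ⟨f, (S − T)f⟩ ≥ (1 − r)⟨f, Sf⟩ > 0
  have hposR : PosDefEnd (𝔬.S0 U - (𝔬.Tpi U + 𝔬.T2 U)) := fun f hf => by
    have h0 : 0 < f ⬝ᵥ 𝔬.S0 U f := hF.posS0 f hf
    have h1 : f ⬝ᵥ (𝔬.Tpi U + 𝔬.T2 U) f ≤ r * (f ⬝ᵥ 𝔬.S0 U f) := (abs_le.mp (hF.small1 f)).2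
    have h2 : r * (f ⬝ᵥ 𝔬.S0 U f) < f ⬝ᵥ 𝔬.S0 U f := mul_lt_of_lt_one_left h0 hr
    rw [LinearMap.sub_apply, dotProduct_sub]
    linarith
  have hEq : 𝔬.S0 U - (𝔬.Tpi U + 𝔬.T2 U) = (cR39 (trBasis N))⁻¹ •
      coordOpK (trBasis N) (fun _ : Fin (d + 1) => (deltaOneY i (parSymY i) (parBY i) (GpPhysY i (parSymY i)) Δ2 (cfg U)).restrictScalars ℝ) := by
    have hfam : (fun _ : Fin (d + 1) => (deltaOneY i (parSymY i) (parBY i) (GpPhysY i (parSymY i)) Δ2 (cfg U)).restrictScalars ℝ) =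
        fun _ : Fin (d + 1) => (deltaAY i (parSymY i) (parBY i) (GpPhysY i (parSymY i)) (cfg U)).restrictScalars ℝ -
          ((deltaPiPrimeY i (parSymY i) (GpPhysY i (parSymY i)) (cfg U)).restrictScalars ℝ +
            (delta2PiY i (parSymY i) (GpPhysY i (parSymY i)) Δ2 (cfg U)).restrictScalars ℝ) := by
      funext ν
      apply LinearMap.ext
      intro v
      simp only [LinearMap.coe_restrictScalars, LinearMap.sub_apply, LinearMap.add_apply, deltaOneY_eq_deltaAY_sub]
    rw [hS0, hTpi, hT2, hfam, coordOpK_sub, coordOpK_add, smul_sub, smul_add]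
    rfl
  rw [hEq] at hposR
  -- positivity survives the positive scalar c⁻¹
  have hposR' : PosDefEnd (coordOpK (trBasis N)
      (fun _ : Fin (d + 1) => (deltaOneY i (parSymY i) (parBY i) (GpPhysY i (parSymY i)) Δ2 (cfg U)).restrictScalars ℝ)) := fun f hf => by
    have h := hposR f hf
    rw [LinearMap.smul_apply, dotProduct_smul, smul_eq_mul] at h
    exact (mul_pos_iff_of_pos_left (inv_pos.mpr hc)).mp h
  exact posDefTr_of_posDefEnd_coordOpK_const hN _ hposR'

/-! ## §2 The ten definitional Sect.-D identities at the PHYS pins (n06-l `identitiesDef_of_pins` re-based; def-Y's algebra is `G′`-generic) -/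

section IdentitiesPhys

/-- `symmR` at the phys pins: the `R`-model at `G′_phys` is its own transpose for a `G`-valued configuration, `G ≤ U(N)` (the model IS the lattice one —
dag-n06-l `rcoK_GpPhysY`, def-Y `RY_GpPhysY`).
[cite: Balaban1985BackgroundPropagators, (3.25) p.394, Thm 3.11 p.416 («symmetric»)] -/
theorem isTransposePair_RcoK_phys (i : KIdx d ℓ hd hL b₀ b₁) (B : B9.Backgrounds) (cfg : B.Cfg → CfgY (Matrix (Fin N) (Fin N) ℂ) i) (U₁ : B.Cfg)
    {G : Subgroup (Matrix (Fin N) (Fin N) ℂ)ˣ} (hG : G ≤ B7Prop2Explicit.unitaryUnits (Matrix (Fin N) (Fin N) ℂ)) (hU : ∀ μ x, cfg U₁ μ x ∈ G) :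
    IsTransposePair (RcoK i (trBasis N) B cfg (parSymY i) (GpPhysY i (parSymY i)) U₁) (RcoK i (trBasis N) B cfg (parSymY i) (GpPhysY i (parSymY i)) U₁) := by
  rw [B9PerturbationMajorantsAtLettersPhys.rcoK_GpPhysY]
  exact isTransposePair_RcoK i B cfg U₁ hG hU

/-- ★★ **THE TEN DEFINITIONAL SECT.-D IDENTITIES AT THE PHYS PINS**: n06-l's `identitiesDef_of_pins` with the Sect.-D letters read at `G′_phys = GpPhysY i (parSymY i)`
and the Sect. A–C letter `G = Δ_a⁻¹` and its unit `hUa` kept at the lattice letter (the SAME operators, def-Y `GAY_GpPhysY ∕ deltaAY_GpPhysY` — the shapes the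
certificate's `hG0co12` pin and `hΔA` display); the three inverse identities from the three units, (3.126)∕(3.129)∕(3.153)∕`c1_inv` by def-Y's `G′`-generic
algebra, the three transposes over `trBasis N`.
[cite: Balaban1985BackgroundPropagators, (3.122)–(3.132) pp.420–422, (3.153) p.426, Thm 3.11 p.416] -/
theorem identitiesDef_of_pins_phys (i : KIdx d ℓ hd hL b₀ b₁) (B : B9.Backgrounds) (cfg : B.Cfg → CfgY (Matrix (Fin N) (Fin N) ℂ) i)
    (Δ2 : BondOpY (Matrix (Fin N) (Fin N) ℂ) i) {g : B9.Geometry} {Y : Type}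
    (𝔬 : Ops g B (XBK (TrIdx N) i) Y (XHK (TrIdx N) i) (XSK (TrIdx N) i)) (U₁ : B.Cfg) (hN : 0 < N)
    {G : Subgroup (Matrix (Fin N) (Fin N) ℂ)ˣ} (hG : G ≤ B7Prop2Explicit.unitaryUnits (Matrix (Fin N) (Fin N) ℂ))
    (hU : ∀ μ x, cfg U₁ μ x ∈ G)
    (hUa : IsUnit (deltaAY i (parSymY i) (parBY i) (GpY i (parSymY i)) (cfg U₁)))
    (hUπ : IsUnit (deltaPiAY i (parSymY i) (parBY i) (GpPhysY i (parSymY i)) (cfg U₁)))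
    (hU1 : IsUnit (deltaOneY i (parSymY i) (parBY i) (GpPhysY i (parSymY i)) Δ2 (cfg U₁)))
    (hUQ : IsUnit (QGQOfY i (parBY i) (G1Y i (parSymY i) (parBY i) (GpPhysY i (parSymY i)) Δ2) (cfg U₁)))
    (hG0 : 𝔬.G0 U₁ = GcoK i (trBasis N) B cfg (GAY i (parSymY i) (parBY i) (GpY i (parSymY i))) U₁)
    (hS0 : 𝔬.S0 U₁ = S0coK i (trBasis N) B cfg (parSymY i) (parBY i) (GpPhysY i (parSymY i)) U₁)
    (hTpi : 𝔬.Tpi U₁ = TpicoK i (trBasis N) B cfg (parSymY i) (GpPhysY i (parSymY i)) U₁)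
    (hT2 : 𝔬.T2 U₁ = T2coK i (trBasis N) B cfg (parSymY i) (GpPhysY i (parSymY i)) Δ2 U₁)
    (hGD : 𝔬.G U₁ = GcoK i (trBasis N) B cfg (GDY i (parSymY i) (parBY i) (GpPhysY i (parSymY i))) U₁)
    (hG1 : 𝔬.G1 U₁ = GcoK i (trBasis N) B cfg (G1Y i (parSymY i) (parBY i) (GpPhysY i (parSymY i)) Δ2) U₁)
    (hGG : 𝔬.GG U₁ = GcoK i (trBasis N) B cfg (GGY i (parSymY i) (parBY i) (GpPhysY i (parSymY i)) Δ2) U₁)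
    (hQ : 𝔬.Q U₁ = QcoKH i (trBasis N) B cfg (parBY i) U₁)
    (hQs : 𝔬.Qstar U₁ = QscoKH i (trBasis N) B cfg (parBY i) U₁)
    (hC : 𝔬.C U₁ = CcoK i (trBasis N) B cfg (parSymY i) (parBY i) (GpPhysY i (parSymY i)) U₁)
    (hC1 : 𝔬.C1 U₁ = C1coK i (trBasis N) B cfg (parSymY i) (parBY i) (GpPhysY i (parSymY i)) Δ2 U₁)
    (hHm : 𝔬.Hm U₁ = HcoK i (trBasis N) B cfg (HDY i (parSymY i) (parBY i) (GpPhysY i (parSymY i))) U₁)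
    (hH1m : 𝔬.H1m U₁ = HcoK i (trBasis N) B cfg (H1Y i (parSymY i) (parBY i) (GpPhysY i (parSymY i)) Δ2) U₁)
    (hDv : 𝔬.Dv U₁ = DvcoKH i (trBasis N) B cfg U₁)
    (hDvs : 𝔬.Dvstar U₁ = DvscoKH i (trBasis N) B cfg U₁)
    (hR : 𝔬.R U₁ = RcoK i (trBasis N) B cfg (parSymY i) (GpPhysY i (parSymY i)) U₁) :
    IdentitiesDef 𝔬 U₁ := by
  have hc : cR39 (trBasis N) ≠ 0 := (cR39_trBasis_pos hN).ne'
  have hUu : ∀ μ x, ((cfg U₁ μ x : (Matrix (Fin N) (Fin N) ℂ)ˣ) : Matrix (Fin N) (Fin N) ℂ) ∈ unitary (Matrix (Fin N) (Fin N) ℂ) :=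
    fun μ x => B7Prop2Explicit.mem_unitaryUnits.mp (hG (hU μ x))
  refine
    { invG0' := ?_
      invG := ?_
      invG1 := ?_
      eq126 := ?_
      eq129 := ?_
      eq153 := ?_
      c1_inv := ?_
      adjQ := ?_
      adjDv := ?_
      symmR := ?_ }
  · rw [hG0, hS0, ← GAY_GpPhysY]
    exact GcoK_GAY_mul_S0coK hc ((deltaAY_GpPhysY (parSymY i) (parBY i) (cfg U₁)).symm ▸ hUa)
  · rw [hS0, hTpi, hGD]
    exact S0coK_sub_TpicoK_mul_GcoK_GDY hc hUπ
  · rw [hS0, hTpi, hT2, hG1]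
    exact S0coK_sub_mul_GcoK_G1Y hc hU1
  · rw [hHm, hGD, hQs, hC]
    exact HcoK_HDY_eq hc U₁
  · rw [hH1m, hG1, hQs, hC1]
    exact HcoK_H1Y_eq hc U₁
  · rw [frakPstar, hGG, hG1, hQs, hC1, hQ, hDv, hR, hDvs]
    exact GcoK_GGY_eq_frakPstar hc U₁
  · rw [hQ, hG1, hQs, hC1]
    exact QcoKH_G1_Qs_C1_eq_id hc hUQ
  · rw [hQ, hQs]
    exact isTransposePair_QcoKH_QscoKH i B cfg U₁ hG hU
  · rw [hDv, hDvs]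
    exact isTransposePair_DvcoKH_DvscoKH i B cfg U₁ hUu
  · rw [hR]
    exact isTransposePair_RcoK_phys i B cfg U₁ hG hU

/-- the unit `Δ_a(U)` at `G′_phys` from the certificate's displayed positivity of `Δ_a(U)` at `G′_latt` (the SAME operator, def-Y `deltaAY_GpPhysY`).
[cite: Balaban1985BackgroundPropagators, (3.26)–(3.27) p.395, Thm 3.11 p.416] -/
theorem isUnit_deltaAY_phys_of_posDefTr (i : KIdx d ℓ hd hL b₀ b₁) {U : CfgY (Matrix (Fin N) (Fin N) ℂ) i}
    (hΔA : PosDefTr (fun _ => (1 : ℝ)) (deltaAY i (parSymY i) (parBY i) (GpY i (parSymY i)) U)) :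
    IsUnit (deltaAY i (parSymY i) (parBY i) (GpPhysY i (parSymY i)) U) := by
  rw [deltaAY_GpPhysY]
  exact B9Thm311ReadingCoords.isUnit_of_posDefTr hΔA

end IdentitiesPhys

end Summit.QuantumFields.YangMills.BalabanUVNodes.N06SectDUnitsAtPinsPhys

end
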